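import Literature.MathematicalPhysics.QuantumManyBody.BoseGasFreeDirichletBEC
import HarnessLib

/-!
# Crux `OneBodyEntropyBound` (stmt-AtomisticToContinuum-13440), line `registered`: stub `stub_insertionIntegrable`

Route `BECCellInformation`, problem `BoseEinsteinCondensation` of the summit `AtomisticToContinuum`;
support file for the line's skeleton (namespace `…Cruxes.OneBodyEntropyBound.Birth`).

**Statement** (`stub_insertionIntegrable`, the INSERTION LEMMA for integrable potentials): given the
Dirichlet bosonic floor (`E₀(N,L)·∫|f|² ≤ ∫(|∇f|² + V|f|²)` for every `C¹` `f` vanishing off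
`Λ_L^N`, taken as a hypothesis), for every repulsive finite-range `v` with
`I = ∫_{ℝ³} v(|x|) dx < ∞` and every `κ > 0` there is `ρ₁ > 0` such that for all densities
`0 < ρ < ρ₁`, eventually in `n`, `E₀(n+1, L) ≤ E₀(n, L) + κ` at `L = ((n+1)/ρ)^{1/3}`.

**Proof** (product trial state, position-averaged).
1. *One-body factor.* Dilating the unit bump (`groundStateEnergy_zero_le`) gives `b > 0` and a
   one-particle Dirichlet state `Θ` of `Λ_b` with `𝓔₀[Θ] < κ/4`.
2. *Trial function.* For a `κ/4`-near-minimiser `Φ` of `E₀(n, L)` and a position `z` with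
   `z + Λ_b ⊆ Λ_L`, `f_z = Φ ⊗ Θ(· - z)` (`prodFun`, the new particle last) is `C¹`, vanishes
   off `Λ_L^{n+1}`, has norm `1`, and (`kineticDensity_prodFun`, `interaction_blocks`, Tonelli)
   `𝓔[f_z] = 𝓔[Φ] + ∫|∇Θ|² + CROSS(z)`, `CROSS(z) = ∫ Σᵢ v(|xᵢ - y|) |Φ(X)|² |Θ(y - z)|² dX dy`.
   The floor gives `E₀(n+1, L) ≤ E₀(n, L) + κ/4 + κ/4 + CROSS(z)`.
3. *Averaging.* `∫ CROSS(z) dz = n I` (translation invariance of Lebesgue measure, `‖Θ‖ = 1`),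
   so (first-moment method on `Z = [0, L/2)³`, `b ≤ L/2`) some `z ∈ Z` has
   `CROSS(z) ≤ n I / (L/2)³ ≤ 8 ρ I ≤ κ/4` once `ρ < κ / (32 (I + 1))`; `L ≥ 2b` eventually.
-/

noncomputable section

namespace Summit.AtomisticToContinuum.BoseEinsteinCondensation.Cruxes.OneBodyEntropyBound.Birth

open MeasureTheory Filter Topology
open scoped ENNReal NNReal
open Literature.MathematicalPhysics.QuantumManyBody.BoseGas

namespace InsertionIntegrable

/-- **One-body factor.** For every `ε > 0` there are `b > 0` and a one-particle Dirichlet state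
`Θ` of `Λ_b` with free energy `< ε`: dilate the unit bump (`E₀(0, 1, b) ≤ 𝓔₀[β] / b²`).
[folklore] -/
theorem exists_oneBody_smallEnergy {ε : ℝ} (hε : 0 < ε) :
    ∃ b : ℝ, 0 < b ∧ ∃ Θ : TrialState 1 b, energy 0 Θ < ENNReal.ofReal ε := by
  have hE := energy_unitBump_eq_ofReal
  generalize hE₁ : (energy 0 unitBump).toReal = E₁ at hE
  have hE₁0 : 0 ≤ E₁ := hE₁ ▸ ENNReal.toReal_nonneg
  have hb0 : 0 < E₁ / ε + 1 := by positivity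
  refine ⟨E₁ / ε + 1, hb0, iInf_lt_iff.mp ?_⟩
  refine (groundStateEnergy_zero_le hb0 1).trans_lt ?_
  rw [Nat.cast_one, one_mul, hE, ← ENNReal.ofReal_mul (inv_nonneg.2 (sq_nonneg _)),
    ENNReal.ofReal_lt_ofReal_iff hε]
  have hb1 : E₁ / ε + 1 ≤ (E₁ / ε + 1) ^ 2 := by nlinarith [div_nonneg hE₁0 hε.le]
  calc ((E₁ / ε + 1) ^ 2)⁻¹ * E₁ ≤ (E₁ / ε + 1)⁻¹ * E₁ := by gcongr
    _ < ε := by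
        rw [inv_mul_lt_iff₀ hb0, add_mul, div_mul_cancel₀ _ hε.ne']
        linarith

/-- If `z ∈ [0, L/2)³` and `b ≤ L/2`, the translated small box `z + Λ_b` lies in `Λ_L`. [folklore] -/
theorem mem_box_of_sub_mem_box {L b : ℝ} (hbL : b ≤ L / 2) {z : Space} (hz : z ∈ cell (L / 2))
    {x : Space} (hx : x - z ∈ box b) : x ∈ box L := by
  intro k
  have h1 := hx k
  have h2 := hz k
  simp only [PiLp.sub_apply, Set.mem_Ioo] at h1
  simp only [Set.mem_Ico] at h2
  constructor <;> linarith [h1.1, h1.2, h2.1, h2.2]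

/-- The product `Φ ⊗ Θ(· - z)` vanishes off `Λ_L^{n+1}` when `z + Λ_b ⊆ Λ_L`. [folklore] -/
theorem prodFun_translate_eq_zero {n : ℕ} {L b : ℝ} (Φ : TrialState n L) (Θ : TrialState 1 b)
    {z : Space} (hz : ∀ x : Space, x - z ∈ box b → x ∈ box L)
    {X : Config (n + 1)} (hX : X ∉ boxN (n + 1) L) :
    prodFun Φ.ψ (fun y : Config 1 => Θ.ψ (y - fun _ => z)) X = 0 := by
  simp only [boxN, Set.mem_setOf_eq, not_forall] at hX
  obtain ⟨k, hk⟩ := hX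
  unfold prodFun
  beta_reduce
  rcases exists_eq_castAdd_or k with ⟨i, rfl⟩ | ⟨j, rfl⟩
  · rw [Φ.eq_zero _ (fun h => hk (h i)), zero_mul]
  · rw [Θ.eq_zero (sndCLM n 1 X - fun _ => z) (fun h => hk (hz _ (h j))), mul_zero]

/-- The cross interaction is measurable. [folklore] -/
theorem measurable_crossInteraction {N₁ N₂ : ℕ} {v : ℝ → ℝ≥0∞} (hv : Measurable v) :
    Measurable fun X : Config (N₁ + N₂) => crossInteraction v X := by
  unfold crossInteraction
  refine Finset.measurable_sum _ fun i _ => Finset.measurable_sum _ fun j _ => ?_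
  exact hv.comp ((measurable_pi_apply _).dist (measurable_pi_apply _))

/-- **Energy of the product with one extra particle** (no separation assumed):
`𝓔[ψ₁ ⊗ ψ₂] = 𝓔[ψ₁]‖ψ₂‖² + ‖ψ₁‖² ∫|∇ψ₂|² + ∫ (Σᵢ v(|xᵢ - y|)) |ψ₁(X)|²|ψ₂(y)|²`
(`kineticDensity_prodFun`, block decomposition of the interaction, the one-particle block does
not self-interact, Tonelli). [folklore] -/
theorem lintegral_energyDensity_prodFun_one {n : ℕ} {ψ₁ : Config n → ℂ} {ψ₂ : Config 1 → ℂ}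
    (h₁ : ContDiff ℝ 1 ψ₁) (h₂ : ContDiff ℝ 1 ψ₂) {v : ℝ → ℝ≥0∞} (hv : Measurable v) :
    ∫⁻ X, kineticDensity (prodFun ψ₁ ψ₂) X + interaction v X * ((‖prodFun ψ₁ ψ₂ X‖₊ : ℝ≥0∞)) ^ 2 =
      (∫⁻ Y, kineticDensity ψ₁ Y + interaction v Y * ((‖ψ₁ Y‖₊ : ℝ≥0∞)) ^ 2) *
          (∫⁻ y, ((‖ψ₂ y‖₊ : ℝ≥0∞)) ^ 2) +
        (∫⁻ Y, ((‖ψ₁ Y‖₊ : ℝ≥0∞)) ^ 2) * (∫⁻ y, kineticDensity ψ₂ y) +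
        ∫⁻ X : Config (n + 1), crossInteraction v X *
          (((‖ψ₁ (fun i => X (Fin.castAdd 1 i))‖₊ : ℝ≥0∞)) ^ 2 *
            ((‖ψ₂ (fun i => X (Fin.natAdd n i))‖₊ : ℝ≥0∞)) ^ 2) := by
  have hd₁ := h₁.differentiable one_ne_zero
  have hd₂ := h₂.differentiable one_ne_zero
  have hpt : ∀ X : Config (n + 1),
      kineticDensity (prodFun ψ₁ ψ₂) X + interaction v X * ((‖prodFun ψ₁ ψ₂ X‖₊ : ℝ≥0∞)) ^ 2 =
        (kineticDensity ψ₁ (fun i => X (Fin.castAdd 1 i)) +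
            interaction v (fun i => X (Fin.castAdd 1 i)) *
              ((‖ψ₁ (fun i => X (Fin.castAdd 1 i))‖₊ : ℝ≥0∞)) ^ 2) *
            ((‖ψ₂ (fun i => X (Fin.natAdd n i))‖₊ : ℝ≥0∞)) ^ 2 +
          ((‖ψ₁ (fun i => X (Fin.castAdd 1 i))‖₊ : ℝ≥0∞)) ^ 2 *
            kineticDensity ψ₂ (fun i => X (Fin.natAdd n i)) +
          crossInteraction v X *
            (((‖ψ₁ (fun i => X (Fin.castAdd 1 i))‖₊ : ℝ≥0∞)) ^ 2 *
              ((‖ψ₂ (fun i => X (Fin.natAdd n i))‖₊ : ℝ≥0∞)) ^ 2) := by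
    intro X
    rw [kineticDensity_prodFun hd₁ hd₂, ennnorm_prodFun_sq, interaction_blocks v X,
      interaction_one, add_zero]
    simp only [fstCLM_apply, sndCLM_apply, Function.comp_def]
    ring
  simp_rw [hpt]
  have hm₁ : Measurable fun Y => kineticDensity ψ₁ Y + interaction v Y * ((‖ψ₁ Y‖₊ : ℝ≥0∞)) ^ 2 :=
    measurable_energyDensity hv h₁.continuous
  have hn₁ : Measurable fun Y => ((‖ψ₁ Y‖₊ : ℝ≥0∞)) ^ 2 := measurable_ennnormSq h₁.continuous
  have hn₂ : Measurable fun y => ((‖ψ₂ y‖₊ : ℝ≥0∞)) ^ 2 := measurable_ennnormSq h₂.continuous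
  have hk₂ : Measurable fun y => kineticDensity ψ₂ y := measurable_kineticDensity_any ψ₂
  have hc : Measurable fun X : Config (n + 1) => fun i : Fin n => X (Fin.castAdd 1 i) :=
    measurable_pi_lambda _ fun i => measurable_pi_apply (Fin.castAdd 1 i)
  have hd : Measurable fun X : Config (n + 1) => fun i : Fin 1 => X (Fin.natAdd n i) :=
    measurable_pi_lambda _ fun i => measurable_pi_apply (Fin.natAdd n i)
  have hA : Measurable fun X : Config (n + 1) =>
      (kineticDensity ψ₁ (fun i => X (Fin.castAdd 1 i)) +
          interaction v (fun i => X (Fin.castAdd 1 i)) *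
            ((‖ψ₁ (fun i => X (Fin.castAdd 1 i))‖₊ : ℝ≥0∞)) ^ 2) *
          ((‖ψ₂ (fun i => X (Fin.natAdd n i))‖₊ : ℝ≥0∞)) ^ 2 :=
    (hm₁.comp hc).mul (hn₂.comp hd)
  have hC : Measurable fun X : Config (n + 1) => crossInteraction v X *
      (((‖ψ₁ (fun i => X (Fin.castAdd 1 i))‖₊ : ℝ≥0∞)) ^ 2 *
        ((‖ψ₂ (fun i => X (Fin.natAdd n i))‖₊ : ℝ≥0∞)) ^ 2) :=
    (measurable_crossInteraction hv).mul ((hn₁.comp hc).mul (hn₂.comp hd))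
  rw [lintegral_add_right _ hC, lintegral_add_left hA, lintegral_mul_split hm₁ hn₂,
    lintegral_mul_split hn₁ hk₂]

/-- `∫ |Θ(y - z)|² dz = ‖Θ‖² = 1` for a one-particle state (Lebesgue measure on `ℝ³` is
translation and reflection invariant; `(ℝ³)^1 ≃ ℝ³`). [folklore] -/
theorem lintegral_ennnorm_translate_sq {b : ℝ} (Θ : TrialState 1 b) (y : Config 1) :
    ∫⁻ z : Space, (‖Θ.ψ (y - fun _ => z)‖₊ : ℝ≥0∞) ^ 2 = 1 := by
  have hy : ∀ z : Space, (y - fun _ => z) = fun _ => y 0 - z := by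
    intro z; funext j; rw [Subsingleton.elim j 0]; rfl
  simp_rw [hy]
  calc ∫⁻ z : Space, (‖Θ.ψ (fun _ => y 0 - z)‖₊ : ℝ≥0∞) ^ 2
      = ∫⁻ z : Space, (‖Θ.ψ (fun _ => z)‖₊ : ℝ≥0∞) ^ 2 :=
        lintegral_sub_left_eq_self (fun w : Space => (‖Θ.ψ (fun _ => w)‖₊ : ℝ≥0∞) ^ 2) (y 0)
    _ = ∫⁻ Y : Config 1, (‖Θ.ψ (fun _ => Y 0)‖₊ : ℝ≥0∞) ^ 2 :=
        (lintegral_funUnique_comp (fun w : Space => (‖Θ.ψ (fun _ => w)‖₊ : ℝ≥0∞) ^ 2)).symm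
    _ = ∫⁻ Y : Config 1, (‖Θ.ψ Y‖₊ : ℝ≥0∞) ^ 2 :=
        lintegral_congr fun Y => congrArg (fun W : Config 1 => (‖Θ.ψ W‖₊ : ℝ≥0∞) ^ 2)
          (const_apply_zero_eq Y)
    _ = 1 := Θ.norm_eq

/-- `∫ (Σᵢ v(|xᵢ - y|)) |Φ(X)|² dX dy = n ∫ v(|x|) dx` for a normalised `n`-particle `Φ`
(Tonelli along `(ℝ³)^{n+1} ≃ (ℝ³)^n × (ℝ³)^1`, translation invariance). [folklore] -/
theorem lintegral_cross_normSq {n : ℕ} {L : ℝ} (Φ : TrialState n L) {v : ℝ → ℝ≥0∞}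
    (hv : Measurable v) :
    ∫⁻ X : Config (n + 1), crossInteraction v X *
        (‖Φ.ψ (fun i => X (Fin.castAdd 1 i))‖₊ : ℝ≥0∞) ^ 2 = n * ∫⁻ x : Space, v ‖x‖ := by
  have hgm : Measurable fun p : Config n × Config 1 =>
      (∑ i : Fin n, v (dist (p.1 i) (p.2 0))) * (‖Φ.ψ p.1‖₊ : ℝ≥0∞) ^ 2 := by
    refine Measurable.mul ?_ ((measurable_ennnormSq Φ.contDiff.continuous).comp measurable_fst)
    refine Finset.measurable_sum _ fun i _ => ?_
    exact hv.comp (by fun_prop)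
  have hcomp : ∀ X : Config (n + 1),
      crossInteraction v X * (‖Φ.ψ (fun i => X (Fin.castAdd 1 i))‖₊ : ℝ≥0∞) ^ 2 =
        (fun p : Config n × Config 1 =>
          (∑ i : Fin n, v (dist (p.1 i) (p.2 0))) * (‖Φ.ψ p.1‖₊ : ℝ≥0∞) ^ 2)
          (splitConfig n 1 X) := by
    intro X
    simp only [crossInteraction, Fin.sum_univ_one, splitConfig_fst, splitConfig_apply_snd]
  have hI : ∀ (Y : Config n) (i : Fin n),
      ∫⁻ y : Config 1, v (dist (Y i) (y 0)) = ∫⁻ x : Space, v ‖x‖ := by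
    intro Y i
    rw [lintegral_funUnique_comp (fun x => v (dist (Y i) x))]
    simp_rw [dist_comm (Y i), dist_eq_norm]
    exact lintegral_sub_right_eq_self (fun x : Space => v ‖x‖) (Y i)
  have hsm : ∀ Y : Config n, Measurable fun y : Config 1 => ∑ i : Fin n, v (dist (Y i) (y 0)) :=
    fun Y => Finset.measurable_sum _ fun i _ =>
      hv.comp (measurable_const.dist (measurable_pi_apply 0))
  have hinner : ∀ Y : Config n,
      ∫⁻ y : Config 1, (∑ i : Fin n, v (dist (Y i) (y 0))) * (‖Φ.ψ Y‖₊ : ℝ≥0∞) ^ 2 =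
        (n * ∫⁻ x : Space, v ‖x‖) * (‖Φ.ψ Y‖₊ : ℝ≥0∞) ^ 2 := by
    intro Y
    rw [lintegral_mul_const _ (hsm Y),
      lintegral_finsetSum Finset.univ (f := fun (i : Fin n) (y : Config 1) => v (dist (Y i) (y 0)))
        (fun i _ => hv.comp (measurable_const.dist (measurable_pi_apply 0)))]
    simp only [hI, Finset.sum_const, Finset.card_univ, Fintype.card_fin, nsmul_eq_mul]
  simp_rw [hcomp]
  rw [(volume_preserving_splitConfig n 1).lintegral_comp_emb (splitConfig n 1).measurableEmbedding
      (fun p : Config n × Config 1 =>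
        (∑ i : Fin n, v (dist (p.1 i) (p.2 0))) * (‖Φ.ψ p.1‖₊ : ℝ≥0∞) ^ 2),
    lintegral_prod _ hgm.aemeasurable]
  simp_rw [hinner]
  rw [lintegral_const_mul _ (measurable_ennnormSq Φ.contDiff.continuous), Φ.norm_eq, mul_one]

/-- Joint measurability of the integrand of the cross term in the position `z` and the
configuration. [folklore] -/
theorem measurable_cross_integrand {n : ℕ} {L b : ℝ} (Φ : TrialState n L) (Θ : TrialState 1 b)
    {v : ℝ → ℝ≥0∞} (hv : Measurable v) :
    Measurable fun p : Space × Config (n + 1) => crossInteraction v p.2 *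
      ((‖Φ.ψ (fun i => p.2 (Fin.castAdd 1 i))‖₊ : ℝ≥0∞) ^ 2 *
        (‖Θ.ψ ((fun i => p.2 (Fin.natAdd n i)) - fun _ => p.1)‖₊ : ℝ≥0∞) ^ 2) := by
  have h1 : Measurable fun p : Space × Config (n + 1) => crossInteraction v p.2 :=
    (measurable_crossInteraction hv).comp measurable_snd
  have hc₁ : Measurable fun p : Space × Config (n + 1) => fun i : Fin n => p.2 (Fin.castAdd 1 i) :=
    measurable_pi_lambda _ fun i => (measurable_pi_apply (Fin.castAdd 1 i)).comp measurable_snd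
  have h2 : Measurable fun p : Space × Config (n + 1) =>
      (‖Φ.ψ (fun i => p.2 (Fin.castAdd 1 i))‖₊ : ℝ≥0∞) ^ 2 :=
    (measurable_ennnormSq Φ.contDiff.continuous).comp hc₁
  have hc : Continuous fun p : Space × Config (n + 1) =>
      ((fun i => p.2 (Fin.natAdd n i)) - fun _ => p.1 : Config 1) :=
    continuous_pi fun i => ((continuous_apply (Fin.natAdd n i)).comp continuous_snd).sub
      continuous_fst
  have h3 : Measurable fun p : Space × Config (n + 1) =>
      (‖Θ.ψ ((fun i => p.2 (Fin.natAdd n i)) - fun _ => p.1)‖₊ : ℝ≥0∞) ^ 2 :=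
    ((Θ.contDiff.continuous.comp hc).measurable.nnnorm.coe_nnreal_ennreal).pow_const 2
  exact h1.mul (h2.mul h3)

/-- **The position average of the cross term**: `∫ CROSS(z) dz = n ∫ v(|x|) dx`. [folklore] -/
theorem lintegral_lintegral_cross {n : ℕ} {L b : ℝ} (Φ : TrialState n L) (Θ : TrialState 1 b)
    {v : ℝ → ℝ≥0∞} (hv : Measurable v) :
    ∫⁻ z : Space, ∫⁻ X : Config (n + 1), crossInteraction v X *
        ((‖Φ.ψ (fun i => X (Fin.castAdd 1 i))‖₊ : ℝ≥0∞) ^ 2 *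
          (‖Θ.ψ ((fun i => X (Fin.natAdd n i)) - fun _ => z)‖₊ : ℝ≥0∞) ^ 2) =
      n * ∫⁻ x : Space, v ‖x‖ := by
  rw [lintegral_lintegral_swap (measurable_cross_integrand Φ Θ hv).aemeasurable]
  have hmz : ∀ y : Config 1, Measurable fun z : Space => (‖Θ.ψ (y - fun _ => z)‖₊ : ℝ≥0∞) ^ 2 := by
    intro y
    have hc : Continuous fun z : Space => (y - fun _ => z : Config 1) :=
      continuous_const.sub (continuous_pi fun _ => continuous_id)
    exact ((Θ.contDiff.continuous.comp hc).measurable.nnnorm.coe_nnreal_ennreal).pow_const 2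
  have hinner : ∀ X : Config (n + 1), ∫⁻ z : Space, crossInteraction v X *
      ((‖Φ.ψ (fun i => X (Fin.castAdd 1 i))‖₊ : ℝ≥0∞) ^ 2 *
        (‖Θ.ψ ((fun i => X (Fin.natAdd n i)) - fun _ => z)‖₊ : ℝ≥0∞) ^ 2) =
      crossInteraction v X * (‖Φ.ψ (fun i => X (Fin.castAdd 1 i))‖₊ : ℝ≥0∞) ^ 2 := by
    intro X
    simp_rw [← mul_assoc]
    rw [lintegral_const_mul _ (hmz _), lintegral_ennnorm_translate_sq, mul_one]
  simp_rw [hinner]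
  exact lintegral_cross_normSq Φ hv

/-- **One insertion at position `z`.** If the floor holds for `n + 1` particles in `Λ_L`, then
for every `n`-particle Dirichlet state `Φ` of `Λ_L`, every one-particle state `Θ` of `Λ_b` and
every `z` with `z + Λ_b ⊆ Λ_L`: `E₀(n+1, L) ≤ 𝓔[Φ] + 𝓔₀[Θ] + CROSS(z)`. [folklore] -/
theorem groundStateEnergy_succ_le_cross {n : ℕ} {L b : ℝ} {v : ℝ → ℝ≥0∞} (hv : Measurable v)
    (hfloorN : ∀ f : Config (n + 1) → ℂ, ContDiff ℝ 1 f → (∀ X, X ∉ boxN (n + 1) L → f X = 0) →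
      groundStateEnergy v (n + 1) L * ∫⁻ X, (‖f X‖₊ : ℝ≥0∞) ^ 2 ≤
        ∫⁻ X, (kineticDensity f X + interaction v X * (‖f X‖₊ : ℝ≥0∞) ^ 2))
    (Φ : TrialState n L) (Θ : TrialState 1 b) {z : Space}
    (hz : ∀ x : Space, x - z ∈ box b → x ∈ box L) :
    groundStateEnergy v (n + 1) L ≤ energy v Φ + energy 0 Θ +
      ∫⁻ X : Config (n + 1), crossInteraction v X *
        ((‖Φ.ψ (fun i => X (Fin.castAdd 1 i))‖₊ : ℝ≥0∞) ^ 2 *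
          (‖Θ.ψ ((fun i => X (Fin.natAdd n i)) - fun _ => z)‖₊ : ℝ≥0∞) ^ 2) := by
  have hθc : ContDiff ℝ 1 (fun y : Config 1 => Θ.ψ (y - fun _ => z)) :=
    Θ.contDiff.comp (contDiff_id.sub contDiff_const)
  have hθn : ∫⁻ y : Config 1, (‖Θ.ψ (y - fun _ => z)‖₊ : ℝ≥0∞) ^ 2 = 1 :=
    (lintegral_sub_right_eq_self (μ := (volume : Measure (Config 1)))
      (fun y => (‖Θ.ψ y‖₊ : ℝ≥0∞) ^ 2) (fun _ => z)).trans Θ.norm_eq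
  have hθk : ∫⁻ y, kineticDensity (fun y : Config 1 => Θ.ψ (y - fun _ => z)) y ≤ energy 0 Θ := by
    simp only [kineticDensity_translate]
    refine (lintegral_sub_right_eq_self (μ := (volume : Measure (Config 1)))
      (fun y => kineticDensity Θ.ψ y) (fun _ => z)).trans_le ?_
    exact lintegral_mono fun y => le_self_add
  have hE : (∫⁻ Y, kineticDensity Φ.ψ Y + interaction v Y * (‖Φ.ψ Y‖₊ : ℝ≥0∞) ^ 2) =
      energy v Φ := rfl
  have hf := hfloorN _ (contDiff_prodFun Φ.contDiff hθc)
    (fun X hX => prodFun_translate_eq_zero Φ Θ hz hX)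
  rw [lintegral_ennnorm_prodFun_sq Φ.contDiff.continuous hθc.continuous, Φ.norm_eq, hθn,
    mul_one, mul_one, lintegral_energyDensity_prodFun_one Φ.contDiff hθc hv, hθn, Φ.norm_eq,
    mul_one, one_mul, hE] at hf
  exact hf.trans (add_le_add_three le_rfl hθk le_rfl)

/-- Elementary bookkeeping of the constants: `n I / (L/2)³ ≤ κ/4` when `L³ = (n+1)/ρ` and
`ρ < κ / (32 (I + 1))`. [folklore] -/
theorem density_bound {κ Ir ρ L : ℝ} {n : ℕ} (hIr : 0 ≤ Ir) (hρ : 0 < ρ)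
    (hρ₁ : ρ < κ / (32 * (Ir + 1))) (hL : L ^ 3 = ((n : ℝ) + 1) / ρ) (hL0 : 0 < L) :
    (n : ℝ) * Ir / (L / 2) ^ 3 ≤ κ / 4 := by
  have h32 : 32 * ρ * (Ir + 1) ≤ κ := by
    have := (lt_div_iff₀ (by positivity)).1 hρ₁
    linarith
  have hL3 : (L / 2) ^ 3 = ((n : ℝ) + 1) / (8 * ρ) := by
    rw [div_pow, hL]
    field_simp
    ring
  rw [div_le_iff₀ (by positivity), hL3, mul_div_assoc', le_div_iff₀ (by positivity)]
  have hn : (0 : ℝ) ≤ n := n.cast_nonneg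
  calc (n : ℝ) * Ir * (8 * ρ) ≤ ((n : ℝ) + 1) * (Ir + 1) * (8 * ρ) := by gcongr <;> linarith
    _ = 32 * ρ * (Ir + 1) / 4 * ((n : ℝ) + 1) := by ring
    _ ≤ κ / 4 * ((n : ℝ) + 1) := by gcongr

end InsertionIntegrable

open InsertionIntegrable in
/-- **Stub `stub_insertionIntegrable` (insertion lemma, integrable potentials).** Given the
Dirichlet bosonic floor, for every repulsive finite-range `v` with `∫ v(|x|) dx < ∞` and every
`κ > 0` there is `ρ₁ > 0` such that for all `0 < ρ < ρ₁`, eventually in `n`,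
`E₀(n+1, L) ≤ E₀(n, L) + κ` at `L = ((n+1)/ρ)^{1/3}`: product trial state `Φ ⊗ Θ(· - z)` with
`Φ` a near-minimiser of `E₀(n, L)`, `Θ` a dilated one-particle bump, and the position `z`
chosen by averaging the cross interaction (`≤ 8ρ ∫ v`). [folklore] -/
theorem stub_insertionIntegrable :
    (∀ (N : ℕ) (L : ℝ) (v : ℝ → ENNReal), Measurable v →
      ∀ f : Literature.MathematicalPhysics.QuantumManyBody.BoseGas.Config N → ℂ, ContDiff ℝ 1 f →
        (∀ X, X ∉ Literature.MathematicalPhysics.QuantumManyBody.BoseGas.boxN N L → f X = 0) →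
        Literature.MathematicalPhysics.QuantumManyBody.BoseGas.groundStateEnergy v N L *
            ∫⁻ X, (‖f X‖₊ : ENNReal) ^ 2 ≤
          ∫⁻ X, (Literature.MathematicalPhysics.QuantumManyBody.BoseGas.kineticDensity f X +
            Literature.MathematicalPhysics.QuantumManyBody.BoseGas.interaction v X * (‖f X‖₊ : ENNReal) ^ 2)) →
    ∀ v : ℝ → ENNReal, Literature.MathematicalPhysics.QuantumManyBody.BoseGas.IsRepulsiveFiniteRange v →
      (∫⁻ x : EuclideanSpace ℝ (Fin 3), v ‖x‖) ≠ ⊤ →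
      ∀ κ : ℝ, 0 < κ → ∃ ρ₁ : ℝ, 0 < ρ₁ ∧ ∀ ρ : ℝ, 0 < ρ → ρ < ρ₁ →
        ∀ᶠ n : ℕ in Filter.atTop,
          Literature.MathematicalPhysics.QuantumManyBody.BoseGas.groundStateEnergy v (n + 1)
              (Literature.MathematicalPhysics.QuantumManyBody.BoseGas.sideLength ρ (n + 1)) ≤
            Literature.MathematicalPhysics.QuantumManyBody.BoseGas.groundStateEnergy v n
              (Literature.MathematicalPhysics.QuantumManyBody.BoseGas.sideLength ρ (n + 1)) + ENNReal.ofReal κ := by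
  intro hfloor v hv hI κ hκ
  have hκ4 : 0 < κ / 4 := by positivity
  obtain ⟨b, hb, Θ, hΘ⟩ := exists_oneBody_smallEnergy hκ4
  -- the integral of the potential, as a real number
  set I : ℝ≥0∞ := ∫⁻ x : Space, v ‖x‖ with hIdef
  have hIr : I = ENNReal.ofReal I.toReal := (ENNReal.ofReal_toReal hI).symm
  refine ⟨κ / (32 * (I.toReal + 1)), by positivity, fun ρ hρ hρ₁ => ?_⟩
  have hL : ∀ᶠ n : ℕ in atTop, 2 * b ≤ sideLength ρ (n + 1) :=
    ((tendsto_sideLength_atTop hρ).comp (tendsto_add_atTop_nat 1)).eventually_ge_atTop (2 * b)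
  filter_upwards [hL] with n hn
  set L := sideLength ρ (n + 1) with hLdef
  have hL0 : 0 < L := by linarith
  have hbL : b ≤ L / 2 := by linarith
  have hL3 : L ^ 3 = ((n : ℝ) + 1) / ρ := by
    rw [hLdef, sideLength_pow_three hρ (n + 1)]
    push_cast
    rfl
  -- nothing to prove if `E₀(n, L) = ∞`
  rcases eq_or_ne (groundStateEnergy v n L) ⊤ with htop | htop
  · rw [htop, top_add]; exact le_top
  -- a `κ/4`-near-minimiser of `E₀(n, L)`
  have hlt : groundStateEnergy v n L < groundStateEnergy v n L + ENNReal.ofReal (κ / 4) :=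
    ENNReal.lt_add_right htop (ENNReal.ofReal_pos.2 hκ4).ne'
  obtain ⟨Φ, hΦ⟩ := iInf_lt_iff.mp hlt
  -- the cross term as a function of the position of the inserted particle
  set CROSS : Space → ℝ≥0∞ := fun z => ∫⁻ X : Config (n + 1), crossInteraction v X *
    ((‖Φ.ψ (fun i => X (Fin.castAdd 1 i))‖₊ : ℝ≥0∞) ^ 2 *
      (‖Θ.ψ ((fun i => X (Fin.natAdd n i)) - fun _ => z)‖₊ : ℝ≥0∞) ^ 2) with hCROSS
  have hmeas : Measurable CROSS :=
    (measurable_cross_integrand Φ Θ hv.1).lintegral_prod_right'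
  have havg : ∫⁻ z, CROSS z = n * I := lintegral_lintegral_cross Φ Θ hv.1
  -- the insertion window `Z = [0, L/2)³`
  have hvol : volume (cell (L / 2)) = ENNReal.ofReal ((L / 2) ^ 3) := by
    rw [volume_cell, ENNReal.ofReal_pow (by positivity)]
  have hZ0 : volume (cell (L / 2)) ≠ 0 := by
    rw [hvol]; exact (ENNReal.ofReal_pos.2 (by positivity)).ne'
  have hZtop : volume (cell (L / 2)) ≠ ⊤ := by rw [hvol]; exact ENNReal.ofReal_ne_top
  -- first-moment method: a good position
  obtain ⟨z, hz, hzle⟩ := exists_le_setLAverage hZ0 hZtop hmeas.aemeasurable.restrict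
  have hzbound : CROSS z ≤ ENNReal.ofReal (κ / 4) := by
    refine hzle.trans ?_
    rw [setLAverage_eq]
    calc (∫⁻ a in cell (L / 2), CROSS a) / volume (cell (L / 2))
        ≤ (n * I) / volume (cell (L / 2)) :=
          ENNReal.div_le_div_right ((setLIntegral_le_lintegral _ _).trans havg.le) _
      _ = ENNReal.ofReal ((n : ℝ) * I.toReal / (L / 2) ^ 3) := by
          rw [hvol, hIr, ENNReal.toReal_ofReal ENNReal.toReal_nonneg, ← ENNReal.ofReal_natCast,
            ← ENNReal.ofReal_mul (Nat.cast_nonneg n), ENNReal.ofReal_div_of_pos (by positivity)]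
      _ ≤ ENNReal.ofReal (κ / 4) :=
          ENNReal.ofReal_le_ofReal (density_bound ENNReal.toReal_nonneg hρ hρ₁ hL3 hL0)
  -- the floor at the good position
  have hins : groundStateEnergy v (n + 1) L ≤ energy v Φ + energy 0 Θ + CROSS z :=
    groundStateEnergy_succ_le_cross hv.1 (hfloor (n + 1) L v hv.1) Φ Θ
      (fun x hx => mem_box_of_sub_mem_box hbL hz hx)
  calc groundStateEnergy v (n + 1) L ≤ energy v Φ + energy 0 Θ + CROSS z := hins
    _ ≤ (groundStateEnergy v n L + ENNReal.ofReal (κ / 4)) + ENNReal.ofReal (κ / 4) +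
          ENNReal.ofReal (κ / 4) := add_le_add_three hΦ.le hΘ.le hzbound
    _ = groundStateEnergy v n L + ENNReal.ofReal (κ / 4 + κ / 4 + κ / 4) := by
          rw [ENNReal.ofReal_add (by positivity) (by positivity),
            ENNReal.ofReal_add (by positivity) (by positivity), add_assoc, add_assoc, add_assoc]
    _ ≤ groundStateEnergy v n L + ENNReal.ofReal κ := by
          gcongr
          linarith

end Summit.AtomisticToContinuum.BoseEinsteinCondensation.Cruxes.OneBodyEntropyBound.Birth

end
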